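import Summits.QuantumAdvantage.AdviceFreeQNC0.OddPrimeLadder
import HarnessLib
import HarnessLib.Audit.Tags

/-!
# Rung leaf F-Q2-odd (cell qa-qnc0): advice-free `QNC⁰ ⊄ FAC⁰[p]` for EVERY prime `p ≥ 5` — STATEMENT ONLY

Planner qa-qnc0-p2 g14 (D-0145 registration of the odd-prime line). This module ASSERTS NOTHING: it names the rung
leaf the route `OddPrimeWalk` (sub `QuantumAdvantage/QuantumAdvantage`) concludes BY NAME,
`AdviceFreeQNC0Odd : Prop := ∀ p prime, 5 ≤ p → AdviceFreeQNC0Sep p`, tagged `@[conjecture]` (an obligation node,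
provable / refutable by name, never a vendored fact), exactly as the F-Q1 leaf `AdviceFreeQNC0 := AdviceFreeQNC0Sep 2`
(`AdviceFreeQNC0.lean`).  `p = 3` is deliberately excluded: the u-walk instrument is EASY there (`not_walkHardF_three`)
and seat p1 pursues `AdviceFreeQNC0Sep 3` with another relation family (D-walk line).  The landed ladder
`adviceFreeQNC0Sep_of_walkHardF : WalkHardF p → AdviceFreeQNC0Sep p` (OddPrimeLadder.lean) is the route's bridge item.
-/

namespace Summit.QuantumAdvantage.AdviceFreeQNC0

/-- **Rung leaf F-Q2-odd** (closed `Prop`, alt-closer candidate of `QuantumAdvantage/QuantumAdvantage`): for every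
prime `p ≥ 5`, some polynomially-bounded relation family is solved with certainty by advice-free `QNC⁰` and is
`θ`-hard (`θ < 1`) for `FAC⁰[p]` circuit tuples with uniform shared randomness. PRINTED-OPEN (WKST19 §1.3, GK24 §1.3). -/
@[conjecture] def AdviceFreeQNC0Odd : Prop := ∀ (p : ℕ) [Fact p.Prime], 5 ≤ p → AdviceFreeQNC0Sep p

/-- Unfolding lemma: the leaf is literally `∀ p prime, 5 ≤ p → AdviceFreeQNC0Sep p`. [bookkeeping] -/
theorem adviceFreeQNC0Odd_iff :
    AdviceFreeQNC0Odd ↔ ∀ (p : ℕ) [Fact p.Prime], 5 ≤ p → AdviceFreeQNC0Sep p := Iff.rfl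

/-- The route's thesis decides the leaf: `(∀ p ≥ 5 prime, WalkHardF p) → AdviceFreeQNC0Odd` (landed ladder). -/
theorem adviceFreeQNC0Odd_of_walkHardF
    (h : ∀ (p : ℕ) [Fact p.Prime], 5 ≤ p → WalkHardF p) : AdviceFreeQNC0Odd :=
  fun p _ hp => adviceFreeQNC0Sep_of_walkHardF p (h p hp)

end Summit.QuantumAdvantage.AdviceFreeQNC0
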